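import Summits.BirchSwinnertonDyer.BirchSwinnertonDyer.Theorems.ByReductionTypeAtTwoFineSelmerConjAAtTwoAdditivePotGoodCapitulationDoorLayerOne
import Summits.BirchSwinnertonDyer.BirchSwinnertonDyer.Theorems.ByReductionTypeAtTwoFineSelmerConjAAtTwoAdditivePotGoodChevalleyOneBitDoor
import HarnessLib

/-!
# Route `ByReductionTypeAtTwo` (rung K4), crux C1″ `FineSelmerConjAAtTwoAdditivePotGood` (item stmt-BirchSwinnertonDyer-22615):
# THE CAPITULATION DOOR WITH TWO RAMIFIED PRIMES — `v₂ h(L) = v₂ h(K)` for `L/K` quadratic with at most TWO ramified primes, ONE unit of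
# `K` outside `N_{L/K} Lˣ`, and ONE ambiguous class; and its census form `e₁ = e₀` for cubic point fields with two primes above `2`
# (a `--supports 22615` toolkit file; seat `bsd-2adic-k4-w1` GEN 7; sequel of `…CapitulationDoor` (p706944), `…ChevalleyDoorAtTwo`
# (p703318), `…ChevalleyOneBitDoor` (p704661); its census form is consumed together with `…CapitulationCertificate`)

HONEST FRAMING (cell `bsd-2adic`, D-0036/D-0054): UNCONDITIONAL kernel lemmas; closes nothing; nothing booked; BSD is not proved by any of this.

PURPOSE. The capitulation door `padicValNat_two_classNumber_eq_of_ambiguous` (GEN 6) needs `t ≤ 1` ramified prime; three «Fukuda rows»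
of the census (294104f1: `2 = 𝔭₁𝔭₂`; 121440bf1, 460944bn1: `2 = 𝔭²𝔮` in the cubic point field) have TWO primes above `2`. Chevalley's
formula `#Cl(L)^G · 2 · [E_K : E_K ∩ N Lˣ] = h_K · 2^t` still gives `#Cl(L)^G ∣ h_K` when `t ≤ 2` PROVIDED the norm index is even — one
unit of `K` that is not a norm from `L` (`two_dvd_relIndex_of_nonNorm`, GEN 6); the algebraic heart `padicValNat_card_eq_card_fixed` then
runs unchanged:

* `padicValNat_two_classNumber_eq_of_ambiguous_of_nonNorm` — the door with `t ≤ 2` and a non-norm unit;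
* `classNumberPExp_one_eq_classNumberPExp_zero_of_ambiguous_of_nonNorm_unit` — the first layer `K₁ = K(√2)` of the cyclotomic
  `ℤ₂`-tower of a field of odd degree with at most two primes above `2` and a unit `ε ≠ a² − 2b²`;
* `exists_nonNorm_unit_of_padicCert` — the unit from GEN 6's `2`-adic certificate (`ε = (x + yθ + zθ²)/m`, `ε ↦ ±3 (mod 8)` under
  `ℚ(θ) ↪ ℚ₂`), packaged;
(The census rows combine it with `exists_ambiguous_of_certificate` of `…CapitulationCertificate`, the `4 ∤ g(·)` witnesses of
`ncard_primes_above_two_le_two` and the `2`-adic unit certificate.)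

References: [Lang1990] Ch. 13 §4 Lemma 4.1 (PDF p. 203); [Gras2003] II.6.2.3; [Washington1997] §13.1; [Serre1973] Ch. III §1.2 Thm. 1
(Hilbert symbol at `2`).
-/

set_option autoImplicit false
-- sibling precedent (`…CapitulationDoor.lean`): the directory name repeats the summit name
set_option linter.dupNamespace false

noncomputable section

open scoped Classical NumberField nonZeroDivisors

namespace Summit.BirchSwinnertonDyer.BirchSwinnertonDyer.Theorems.AddKatoTwo

open NumberField IsDedekindDomain Polynomial
open Literature.NumberTheory.NumberFields Literature.NumberTheory.NumberFields.AmbiguousClass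
  Literature.NumberTheory.GaloisRepresentations
  Literature.NumberTheory.GaloisRepresentations.Herbrand Literature.NumberTheory.GaloisRepresentations.MinkowskiUnit
  Literature.NumberTheory.GaloisRepresentations.CyclicNormIndex Literature.NumberTheory.IwasawaTheory
  Literature.NumberTheory.EllipticCurves

/-! ## §1 The door with two ramified primes and a non-norm unit -/

section Door

variable {K L : Type} [Field K] [NumberField K] [Field L] [NumberField L] [Algebra K L]

/-- **The capitulation door, two ramified primes.** `L/K` Galois of degree `2`, unramified at the infinite places, at most TWO primes of `K`
ramified in `L`, a unit of `K` that is not a norm from `L`; if a class `c ∈ Cl(L)` is fixed by `Gal(L/K)` and `h_K ∣ m · ord(N_{L/K} c)`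
with `m` odd, then `v₂(h_L) = v₂(h_K)`. (Chevalley: `#Cl(L)^G · 2 · idx = h_K · 2^t` with `2 ∣ idx`, `t ≤ 2` gives `#Cl(L)^G ∣ h_K`;
then `padicValNat_card_eq_card_fixed`.) [cite: Lang1990, Ch. 13 §4, Lemma 4.1 (PDF p. 203)] [cite: Gras2003, II.6.2.3] -/
theorem padicValNat_two_classNumber_eq_of_ambiguous_of_nonNorm [IsGalois K L] [IsUnramifiedAtInfinitePlaces K L]
    (hdeg : Module.finrank K L = 2)
    (ht : {v : HeightOneSpectrum (𝓞 K) | v.asIdeal.ramificationIdxIn (𝓞 L) ≠ 1}.ncard ≤ 2)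
    {u : Lˣ} (hu : u ∈ unitsE L ⊓ (unitsIncl K L).range)
    (hnot : u ∉ unitsE L ⊓ (⊤ : Subgroup Lˣ).map (Herbrand.norm (L ≃ₐ[K] L)))
    {c : ClassGroup (𝓞 L)} (hc : ∀ τ : L ≃ₐ[K] L, ClassGroup.mulEquiv (intAut τ) c = c)
    {m : ℕ} (hm : Odd m) (hN : classNumber K ∣ m * orderOf (classGroupNorm K L c)) :
    padicValNat 2 (classNumber L) = padicValNat 2 (classNumber K) := by
  classical
  haveI : FiniteDimensional K L := Module.Finite.of_restrictScalars_finite ℚ K L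
  have hcard : Nat.card (L ≃ₐ[K] L) = 2 := by rw [IsGalois.card_aut_eq_finrank, hdeg]
  haveI : Fact (Nat.Prime 2) := ⟨Nat.prime_two⟩
  haveI : IsCyclic (L ≃ₐ[K] L) := isCyclic_of_prime_card hcard
  obtain ⟨σ, hσ⟩ := IsCyclic.exists_generator (α := L ≃ₐ[K] L)
  have h := ambiguousClassNumberFormula hσ
  rw [archFactor_eq_one, mul_one, finprod_ramificationIdxIn_eq_pow_of_prime Nat.prime_two hdeg, hdeg] at h
  set t := {v : HeightOneSpectrum (𝓞 K) | v.asIdeal.ramificationIdxIn (𝓞 L) ≠ 1}.ncard with htdef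
  set F := Nat.card {c : ClassGroup (𝓞 L) // ∀ τ : L ≃ₐ[K] L, ClassGroup.mulEquiv (intAut τ) c = c} with hF
  set idx := (unitsE L ⊓ (⊤ : Subgroup Lˣ).map (Herbrand.norm (L ≃ₐ[K] L))).relIndex (unitsE L ⊓ (unitsIncl K L).range)
    with hidx
  obtain ⟨i, hi⟩ := two_dvd_relIndex_of_nonNorm hdeg hu hnot
  rw [← hidx] at hi
  rw [hi] at h
  -- `F · 2 · (2 i) = h_K · 2^t`, `t ≤ 2` ⟹ `F ∣ h_K`
  have hFdvd : F ∣ classNumber K := by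
    interval_cases t
    · exact ⟨4 * i, by rw [pow_zero, mul_one] at h; linarith⟩
    · exact ⟨2 * i, by rw [pow_one] at h; linarith⟩
    · exact ⟨i, by linarith⟩
  -- `σ ≠ 1`, every `τ` is `1` or `σ`, and `σ² = 1`
  have hσ1 : σ ≠ 1 := by
    intro h1
    have : Nat.card (L ≃ₐ[K] L) = 1 := by
      rw [← Subgroup.card_top (G := L ≃ₐ[K] L), ← (Subgroup.eq_top_iff' (Subgroup.zpowers σ)).mpr hσ, h1,
        Subgroup.zpowers_one_eq_bot, Subgroup.card_bot]
    omega
  have hτ : ∀ τ : L ≃ₐ[K] L, τ = 1 ∨ τ = σ := by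
    intro τ
    by_cases h1 : τ = 1
    · exact Or.inl h1
    · right
      obtain ⟨y, -, hy⟩ := (Nat.card_eq_two_iff' (1 : L ≃ₐ[K] L)).mp hcard
      rw [hy τ h1, hy σ hσ1]
  have hσσ : σ * σ = 1 := by
    have h1 : σ ^ Nat.card (L ≃ₐ[K] L) = 1 := pow_card_eq_one'
    rwa [hcard, pow_two] at h1
  set s : ClassGroup (𝓞 L) ≃* ClassGroup (𝓞 L) := ClassGroup.mulEquiv (intAut σ) with hsdef
  have hs : ∀ x, s (s x) = x := by
    intro x
    have h2 := congrArg (fun e => e x) (mulEquiv_intAut_mul (F := K) σ σ)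
    simp only [MulEquiv.trans_apply] at h2
    rw [hσσ, mulEquiv_intAut_one, MulEquiv.refl_apply] at h2
    exact h2.symm
  have hfix_iff : ∀ x : ClassGroup (𝓞 L), (∀ τ : L ≃ₐ[K] L, ClassGroup.mulEquiv (intAut τ) x = x) ↔ s x = x := by
    intro x
    refine ⟨fun hx => hx σ, fun hx τ => ?_⟩
    rcases hτ τ with rfl | rfl
    · rw [mulEquiv_intAut_one, MulEquiv.refl_apply]
    · exact hx
  have hFeq : F = Nat.card {x : ClassGroup (𝓞 L) // s x = x} :=
    Nat.card_congr (Equiv.subtypeEquivRight hfix_iff)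
  haveI : Nonempty {x : ClassGroup (𝓞 L) // s x = x} := ⟨⟨1, map_one s⟩⟩
  set N := classGroupNorm K L with hNdef
  have hNs : ∀ x, N (s x) = N x := fun x => classGroupNorm_galois_smul K L σ x
  have hK0 : classNumber K ≠ 0 := by rw [NumberField.classNumber]; exact Fintype.card_ne_zero
  have hordN0 : orderOf (N c) ≠ 0 := (orderOf_pos (N c)).ne'
  have hm0 : m ≠ 0 := by rintro rfl; exact absurd hm (by decide)
  have hv : padicValNat 2 (Nat.card {x : ClassGroup (𝓞 L) // s x = x}) ≤ padicValNat 2 (orderOf (N c)) := by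
    rw [← hFeq]
    calc padicValNat 2 F ≤ padicValNat 2 (classNumber K) := padicValNat_le_of_dvd' hFdvd hK0
      _ ≤ padicValNat 2 (m * orderOf (N c)) := padicValNat_le_of_dvd' hN (mul_ne_zero hm0 hordN0)
      _ = padicValNat 2 (orderOf (N c)) := padicValNat_odd_mul hm hordN0
  have heart := padicValNat_card_eq_card_fixed s hs N hNs ((hfix_iff c).mp hc) hv
  have hvF : padicValNat 2 F = padicValNat 2 (classNumber K) := by
    apply le_antisymm (padicValNat_le_of_dvd' hFdvd hK0)
    calc padicValNat 2 (classNumber K) ≤ padicValNat 2 (m * orderOf (N c)) :=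
          padicValNat_le_of_dvd' hN (mul_ne_zero hm0 hordN0)
      _ = padicValNat 2 (orderOf (N c)) := padicValNat_odd_mul hm hordN0
      _ ≤ padicValNat 2 (orderOf c) := padicValNat_le_of_dvd' (orderOf_map_dvd N c) (orderOf_pos c).ne'
      _ ≤ padicValNat 2 F := by
          rw [hFeq]
          refine padicValNat_le_of_dvd' ?_ (Nat.card_pos (α := {x : ClassGroup (𝓞 L) // s x = x})).ne'
          have hcs : s c = c := (hfix_iff c).mp hc
          let Fix : Subgroup (ClassGroup (𝓞 L)) :=
            { carrier := {x | s x = x}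
              mul_mem' := fun {a b} ha hb => by simp only [Set.mem_setOf_eq] at ha hb ⊢; rw [map_mul, ha, hb]
              one_mem' := by simp only [Set.mem_setOf_eq, map_one]
              inv_mem' := fun {a} ha => by simp only [Set.mem_setOf_eq] at ha ⊢; rw [map_inv, ha] }
          have := orderOf_dvd_natCard (⟨c, hcs⟩ : Fix)
          rwa [← Subgroup.orderOf_coe (⟨c, hcs⟩ : Fix)] at this
  rw [NumberField.classNumber, ← Nat.card_eq_fintype_card, heart, ← hFeq, hvF]

end Door

/-! ## §2 The first layer of the cyclotomic `ℤ₂`-tower: two primes above `2` and a non-norm unit -/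

section LayerOne

variable {K : Type} [Field K] [NumberField K]

/-- **`e₁ = e₀` from one ambiguous class, two primes above `2` and a non-norm unit.** `K` of odd degree with at most TWO primes above
`2`, `κ` its cyclotomic `ℤ₂`-extension, `K₁ = K(√2)`, `ε ∈ 𝓞 K` a unit with `ε ≠ a² − 2b²` for all `a, b ∈ K`. If some class
`c ∈ Cl(K₁)` is `Gal(K₁/K)`-fixed with `h_K ∣ m · ord(N c)`, `m` odd, then `classNumberPExp κ 1 = classNumberPExp κ 0`.
[cite: Lang1990, Ch. 13 §4, Lemma 4.1] [cite: Washington1997, §13.1] [cite: Gras2003, II.6.2.3] -/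
theorem classNumberPExp_one_eq_classNumberPExp_zero_of_ambiguous_of_nonNorm_unit (hK2 : ¬ 2 ∣ Module.finrank ℚ K)
    (κ : ZpExtension K 2) (hκ : κ.IsCyclotomic) (hs2 : {v : HeightOneSpectrum (𝓞 K) | ((2 : ℕ) : 𝓞 K) ∈ v.asIdeal}.ncard ≤ 2)
    {ε : 𝓞 K} (hεu : IsUnit ε) (hnn : ∀ a b : K, (ε : K) ≠ a ^ 2 - 2 * b ^ 2)
    (hcert : haveI : FiniteDimensional K (κ.layer 1) := κ.finiteDimensional_layer_holds 1;
      haveI : NumberField (κ.layer 1) := NumberField.of_module_finite K (κ.layer 1);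
      ∃ (c : ClassGroup (𝓞 (κ.layer 1))) (m : ℕ), Odd m ∧
        (∀ τ : κ.layer 1 ≃ₐ[K] κ.layer 1, ClassGroup.mulEquiv (intAut τ) c = c) ∧
        classNumber K ∣ m * orderOf (classGroupNorm K (κ.layer 1) c)) :
    classNumberPExp κ 1 = classNumberPExp κ 0 := by
  classical
  haveI : FiniteDimensional K (κ.layer 1) := κ.finiteDimensional_layer_holds 1
  haveI : IsGalois K (κ.layer 1) := κ.isGalois_layer_holds 1
  haveI : NumberField (κ.layer 1) := NumberField.of_module_finite K (κ.layer 1)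
  obtain ⟨c, m, hm, hc, hN⟩ := hcert
  set L := κ.layer 1 with hL
  have hdeg : Module.finrank K L = 2 := by rw [hL, κ.finrank_layer_holds 1, pow_one]
  obtain ⟨s, hs2'⟩ := exists_sq_eq_two_layer_one_of_not_dvd_finrank hK2 κ hκ
  have hsK : ∀ c : K, algebraMap K L c ≠ s := by
    intro c hc
    apply sq_ne_two_of_odd_finrank hK2 c
    apply (algebraMap K L).injective
    rw [map_pow, hc, hs2', map_ofNat]
  have hli : LinearIndependent K ![(1 : L), s] := by
    refine LinearIndependent.pair_iff.mpr fun a b hab => ?_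
    by_cases hb : b = 0
    · subst hb
      simp only [zero_smul, add_zero, smul_eq_zero, one_ne_zero, or_false] at hab
      exact ⟨hab, rfl⟩
    · exfalso
      apply hsK (-(a / b))
      rw [Algebra.smul_def, Algebra.smul_def, mul_one] at hab
      have hb' : algebraMap K L b ≠ 0 := by rwa [Ne, map_eq_zero]
      rw [map_neg, map_div₀, ← neg_div, div_eq_iff hb']
      linear_combination (-1 : L) * hab
  have hspan : ∀ x : L, ∃ a b : K, x = algebraMap K L a + algebraMap K L b * s := by
    intro x
    let B : Module.Basis (Fin 2) K L := basisOfLinearIndependentOfCardEqFinrank hli (by simp [hdeg])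
    have hB : ∀ i, B i = ![(1 : L), s] i := fun i => by simp [B, coe_basisOfLinearIndependentOfCardEqFinrank]
    refine ⟨B.repr x 0, B.repr x 1, ?_⟩
    conv_lhs => rw [← B.sum_repr x]
    rw [Fin.sum_univ_two, hB, hB, Algebra.smul_def, Algebra.smul_def]
    simp
  haveI : IsUnramifiedAtInfinitePlaces K L := isUnramifiedAtInfinitePlaces_of_sq_eq_two hs2' hspan
  -- the generator `σ` and `σ s = -s`
  have hcard : Nat.card (L ≃ₐ[K] L) = 2 := by rw [IsGalois.card_aut_eq_finrank, hdeg]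
  haveI : Fact (Nat.Prime 2) := ⟨Nat.prime_two⟩
  haveI : IsCyclic (L ≃ₐ[K] L) := isCyclic_of_prime_card hcard
  obtain ⟨σ, hσ⟩ := IsCyclic.exists_generator (α := L ≃ₐ[K] L)
  have hσ1 : σ ≠ 1 := by
    intro h1
    have : Nat.card (L ≃ₐ[K] L) = 1 := by
      rw [Nat.card_eq_one_iff_exists]
      refine ⟨1, fun g => ?_⟩
      obtain ⟨k, hk⟩ := Subgroup.mem_zpowers_iff.mp (hσ g)
      rw [← hk, h1, one_zpow]
    omega
  have hσs : σ s = -s := by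
    have hsq : (σ s - s) * (σ s + s) = 0 := by
      have : σ s ^ 2 = 2 := by rw [← map_pow, hs2', map_ofNat]
      linear_combination this - hs2'
    rcases mul_eq_zero.mp hsq with h0 | h0
    · exfalso
      apply hσ1
      have hfix : σ s = s := by linear_combination h0
      ext x
      obtain ⟨a, b, rfl⟩ := hspan x
      rw [map_add, map_mul, AlgEquiv.commutes, AlgEquiv.commutes, hfix, AlgEquiv.one_apply]
    · linear_combination h0
  have huniv : (Finset.univ : Finset (L ≃ₐ[K] L)) = {1, σ} := by
    symm
    apply Finset.eq_univ_of_card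
    rw [Finset.card_pair hσ1.symm, ← Nat.card_eq_fintype_card, hcard]
  -- the unit `u = ι(ε)` is not a norm
  have hε0 : (ε : K) ≠ 0 := by
    intro h0
    have : ε = 0 := by exact_mod_cast h0
    exact hεu.ne_zero this
  set u : Lˣ := unitsIncl K L (Units.mk0 (ε : K) hε0) with hu
  have huE : u ∈ unitsE L ⊓ (unitsIncl K L).range := by
    refine ⟨?_, ⟨_, rfl⟩⟩
    haveI : IsScalarTower (𝓞 K) (𝓞 L) L := IsScalarTower.of_algebraMap_eq fun x => rfl
    refine ⟨Units.map (algebraMap (𝓞 K) (𝓞 L)).toMonoidHom hεu.unit, Units.ext ?_⟩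
    change algebraMap (𝓞 L) L (algebraMap (𝓞 K) (𝓞 L) (hεu.unit : 𝓞 K)) = algebraMap K L (ε : K)
    rw [IsUnit.unit_spec, ← IsScalarTower.algebraMap_apply, IsScalarTower.algebraMap_apply (𝓞 K) K L]
  have hnot : u ∉ unitsE L ⊓ (⊤ : Subgroup Lˣ).map (Herbrand.norm (L ≃ₐ[K] L)) := by
    rintro ⟨-, y, -, hy⟩
    obtain ⟨a, b, hab⟩ := hspan (y : L)
    apply hnn a b
    apply (algebraMap K L).injective
    have hval := congrArg (fun z : Lˣ => (z : L)) hy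
    rw [Herbrand.norm_apply, huniv, Finset.prod_pair hσ1.symm, Units.val_mul, val_smul, val_smul, AlgEquiv.one_apply,
      hab, map_add, map_mul, AlgEquiv.commutes, AlgEquiv.commutes, hσs] at hval
    rw [hu, coe_unitsIncl, Units.val_mk0] at hval
    rw [← hval, map_sub, map_mul, map_pow, map_pow, map_ofNat]
    linear_combination (-(algebraMap K L b) ^ 2) * hs2'
  -- at most two ramified primes
  have ht : {v : HeightOneSpectrum (𝓞 K) | v.asIdeal.ramificationIdxIn (𝓞 L) ≠ 1}.ncard ≤ 2 := by
    have h20 : Ideal.span {((2 : ℕ) : 𝓞 K)} ≠ ⊥ := by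
      rw [Ne, Ideal.span_singleton_eq_bot]; exact_mod_cast Nat.prime_two.ne_zero
    have hfin : {v : HeightOneSpectrum (𝓞 K) | ((2 : ℕ) : 𝓞 K) ∈ v.asIdeal}.Finite := by
      refine (Ideal.finite_factors h20).subset fun v hv => ?_
      exact (Ideal.dvd_span_singleton).mpr hv
    refine le_trans (Set.ncard_le_ncard (fun v hv => ?_) hfin) hs2
    by_contra hpv
    apply hv
    have hunr := κ.isUnramifiedIn_layer_of_not_mem 1 hpv
    haveI : v.asIdeal.IsPrime := v.isPrime
    obtain ⟨⟨P, hPprime, hPover⟩⟩ := (inferInstance : Nonempty (Ideal.primesOver v.asIdeal (𝓞 L)))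
    haveI := hPprime
    haveI := hPover
    rw [Ideal.ramificationIdxIn_eq_ramificationIdx v.asIdeal P (L ≃ₐ[K] L)]
    exact hunr.ramificationIdx_eq_one hPover
  -- the door, and `h(K_0) = h(K)`
  have h1 : classNumberPExp κ 1 = padicValNat 2 (classNumber K) := by
    rw [classNumberPExp_eq_padicValNat_classNumber]
    exact padicValNat_two_classNumber_eq_of_ambiguous_of_nonNorm hdeg ht huE hnot hc hm hN
  have h0 : classNumberPExp κ 0 = padicValNat 2 (classNumber K) := by
    haveI : FiniteDimensional K (κ.layer 0) := κ.finiteDimensional_layer_holds 0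
    haveI : NumberField (κ.layer 0) := NumberField.of_module_finite K (κ.layer 0)
    rw [classNumberPExp_eq_padicValNat_classNumber]
    have e : (κ.layer 0) ≃ₐ[K] K :=
      (IntermediateField.equivOfEq κ.layer_zero).trans (IntermediateField.botEquiv K _)
    have hcl : classNumber (κ.layer 0) = classNumber K :=
      Fintype.card_congr (ClassGroup.mulEquiv (RingOfIntegers.mapRingEquiv e.toRingEquiv)).toEquiv
    rw [hcl]
  rw [h1, h0]

/-! ## §3 The unit from the `2`-adic certificate, and the census form of the door -/

/-- **A non-norm unit of `ℚ(θ)` from the `2`-adic certificate** (the unit construction of `layerOneBit_of_chevalleyCert`, packaged): `θ` a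
root of the irreducible cubic `g = X³ + pX² + qX + r`, `ε = (x + yθ + zθ²)/m` with monic cubic `ε³ + c₁ε² + c₂ε + s = 0`, `s = ±1`
(so `ε ∈ 𝓞 ℚ(θ)` is a unit), and a Hensel datum `a` (`8 ∣ g(a)`, `g'(a)` odd) with `m m' ≡ 1`, `(x + ya + za²) m' ≡ ±3 (mod 8)`; then `ε`
is not of the form `α² − 2β²`, `α, β ∈ ℚ(θ)`. [cite: Serre1973, Ch. III §1.2 Thm. 1] -/
theorem exists_nonNorm_unit_of_padicCert {p q r : ℤ} (hirr : Irreducible (Cubic.toPoly ⟨1, (p : ℚ), q, r⟩))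
    {θ : AlgebraicClosure ℚ} (hθ : aeval θ (Cubic.toPoly ⟨1, (p : ℚ), q, r⟩) = 0)
    (x y z m c₁ c₂ s : ℤ) (hs : s = 1 ∨ s = -1)
    (he : aeval (algebraMap ℚ (AlgebraicClosure ℚ) ((x : ℚ) / m) + algebraMap ℚ (AlgebraicClosure ℚ) ((y : ℚ) / m) * θ +
        algebraMap ℚ (AlgebraicClosure ℚ) ((z : ℚ) / m) * θ ^ 2) (Cubic.toPoly ⟨1, (c₁ : ℚ), c₂, s⟩) = 0)
    (a m' : ℤ) (h8 : (8 : ℤ) ∣ a ^ 3 + p * a ^ 2 + q * a + r) (hodd : ¬ (2 : ℤ) ∣ 3 * a ^ 2 + 2 * p * a + q)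
    (hmm : ((m * m' : ℤ) : ZMod (2 ^ 3)) = 1)
    (hcert : (((x + y * a + z * a ^ 2) * m' : ℤ) : ZMod (2 ^ 3)) = 3 ∨
      (((x + y * a + z * a ^ 2) * m' : ℤ) : ZMod (2 ^ 3)) = 5) :
    ∃ ε : 𝓞 (IntermediateField.adjoin ℚ {θ}), IsUnit ε ∧
      ∀ α β : IntermediateField.adjoin ℚ {θ}, (ε : IntermediateField.adjoin ℚ {θ}) ≠ α ^ 2 - 2 * β ^ 2 := by
  set K := IntermediateField.adjoin ℚ {θ} with hKdef
  have hmem : θ ∈ K := IntermediateField.mem_adjoin_simple_self ℚ θ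
  set eK : K := algebraMap ℚ K ((x : ℚ) / m) + algebraMap ℚ K ((y : ℚ) / m) * ⟨θ, hmem⟩ +
    algebraMap ℚ K ((z : ℚ) / m) * ⟨θ, hmem⟩ ^ 2 with heKdef
  have hecoe : (eK : AlgebraicClosure ℚ) = algebraMap ℚ (AlgebraicClosure ℚ) ((x : ℚ) / m) +
      algebraMap ℚ (AlgebraicClosure ℚ) ((y : ℚ) / m) * θ + algebraMap ℚ (AlgebraicClosure ℚ) ((z : ℚ) / m) * θ ^ 2 := by
    rw [heKdef]; simp only [eq_ratCast]; push_cast; ring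
  have heQ : (eK : AlgebraicClosure ℚ) ^ 3 + (c₁ : AlgebraicClosure ℚ) * (eK : AlgebraicClosure ℚ) ^ 2 +
      (c₂ : AlgebraicClosure ℚ) * (eK : AlgebraicClosure ℚ) + (s : AlgebraicClosure ℚ) = 0 := by
    have := he
    simp only [Cubic.toPoly, map_one, one_mul, aeval_add, aeval_mul, aeval_C, aeval_X_pow, aeval_X,
      eq_ratCast, Rat.cast_intCast] at this
    rw [hecoe]; simp only [eq_ratCast]
    exact this
  have heK : eK ^ 3 + (c₁ : K) * eK ^ 2 + (c₂ : K) * eK + (s : K) = 0 := by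
    apply Subtype.ext
    push_cast
    exact heQ
  set E : 𝓞 K := ⟨eK, ⟨Cubic.toPoly ⟨1, c₁, c₂, s⟩, Cubic.monic_of_a_eq_one', by
    rw [← aeval_def]
    simp only [Cubic.toPoly, map_one, one_mul, aeval_add, aeval_mul, aeval_C, aeval_X_pow, aeval_X]
    simp only [eq_intCast]
    exact heK⟩⟩ with hEdef
  have hE : E ^ 3 + (c₁ : 𝓞 K) * E ^ 2 + (c₂ : 𝓞 K) * E + (s : 𝓞 K) = 0 := by
    apply NumberField.RingOfIntegers.coe_injective
    push_cast
    simp only [hEdef, NumberField.RingOfIntegers.map_mk]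
    exact heK
  have hEu : IsUnit E := by
    refine IsUnit.of_mul_eq_one (-(s : 𝓞 K) * (E ^ 2 + (c₁ : 𝓞 K) * E + (c₂ : 𝓞 K))) ?_
    rcases hs with rfl | rfl
    · push_cast at hE ⊢; linear_combination (-1 : 𝓞 K) * hE
    · push_cast at hE ⊢; linear_combination hE
  have hEcoe : (E : K) = eK := by simp only [hEdef, NumberField.RingOfIntegers.map_mk]
  refine ⟨E, hEu, ?_⟩
  rw [hEcoe, heKdef]
  exact not_sqSubTwoSq_of_padicCert hirr hθ x y z m a m' h8 hodd hmm hcert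

end LayerOne

end Summit.BirchSwinnertonDyer.BirchSwinnertonDyer.Theorems.AddKatoTwo

end
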